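import Literature.NumberTheory.Transcendental.CurvePeriodsChartsProofs
import Literature.NumberTheory.Transcendental.AxDerivationExtension
import Mathlib.Topology.Instances.Matrix
import Mathlib.Topology.Algebra.MvPolynomial
import Mathlib.LinearAlgebra.Matrix.Nondegenerate
import Mathlib.RingTheory.Algebraic.Integral
import Mathlib.Analysis.Complex.Basic
import Mathlib.Analysis.Complex.IsIntegral
import Mathlib.Topology.Algebra.Order.Archimedean
import HarnessLib

/-!
# Periods of curve type: algebraic points of an embedded smooth affine curve are dense

Companion of `Literature/NumberTheory/Transcendental/CurvePeriods.lean` (Huber–Wüstholz 2022,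
Thm. 13.3 (2), rendered on explicit period symbols `(Z, ω, γ)`; the general statement is the named
fact `HuberWustholzCurvePeriods`). The elementary rendering imposes on paths only the boundary
relation (R5) for `C¹` triangles WITH ALGEBRAIC VERTICES, and its docstring justifies the
sufficiency of such triangles by "interior vertices of a bounding 2-chain are moved to nearby
algebraic points …, `Z(ℚ̄)` being dense". This file proves that density statement for every
embedded smooth affine curve over `ℚ̄`, from a purely algebraic lemma of independent interest:

* `derivation_eval` — the chain rule `δ(P(u)) = P^δ(u) + Σᵢ ∂ᵢP(u) · δ(uᵢ)` for a derivation `δ`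
  of `ℂ` and a complex polynomial `P` (`P^δ = derivCoeffs δ P`, `δ` applied to the
  coefficients; `P^δ = 0` when the coefficients are algebraic);
* `isAlgebraic_of_jacobianMinor` — **a non-degenerate solution of a square polynomial system over
  `ℚ̄` is algebraic**: if `z ∈ ℂ^{d+1}` satisfies `d` equations with algebraic coefficients whose
  Jacobian minor in the `d` coordinates other than `x_{i₀}` is invertible at `z`, and `z_{i₀}` is
  algebraic, then all coordinates of `z` are algebraic. Proof: were `zᵢ` transcendental, the
  derivation `∂/∂zᵢ` of `ℂ/ℚ` (`exists_derivation_of_transcendental`, which kills `ℚ̄`,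
  `derivation_eq_zero_of_isAlgebraic`) applied to the equations would give a non-zero kernel
  vector of the invertible minor;
* `dense_setOf_isAlgebraic` — `ℚ̄` is dense in `ℂ`;
* `CurveData.IsSmoothAffineCurve.mem_closure_algebraicPoints` — **`Z(ℚ̄)` is dense in `Z(ℂ)`**
  for every embedded smooth affine curve `Z` over `ℚ̄`: parametrise `Z` near `z₀` by the free
  coordinate `w` of an invertible Jacobian minor (`exists_localChart_of_minor`,
  `CurvePeriodsChartsProofs.lean`), take `w` algebraic and close to `z₀,ᵢ₀`, and apply the
  previous lemma at the point `ψ(w)` (the minor stays invertible near `z₀`).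

## References

* A. Huber, G. Wüstholz, *Transcendence and Linear Relations of 1-Periods*, Cambridge Tracts in
  Mathematics 227, CUP 2022 [HuberWustholz2022]: §3.3.1 (p. 44 of the held text), Thm. 13.3 (2)
  (p. 121).
* S. Lang, *Algebra*, 3rd ed., GTM 211, Springer 2002, Ch. VIII §5 (derivations and algebraic
  dependence).
-/

noncomputable section

open scoped BigOperators Matrix
open MvPolynomial Set

namespace Literature.NumberTheory.Transcendental

namespace CurvePeriods

/-! ### Derivations and polynomial evaluation -/

section Derivations

variable {n : ℕ} (δ : Derivation ℚ ℂ ℂ)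

/-- `P^δ`: the derivation applied to the coefficients of `P`. [folklore] -/
def derivCoeffs (P : MvPolynomial (Fin n) ℂ) : MvPolynomial (Fin n) ℂ :=
  ∑ m ∈ P.support, monomial m (δ (coeff m P))

/-- The coefficients of `P^δ`. [folklore] -/
theorem coeff_derivCoeffs (P : MvPolynomial (Fin n) ℂ) (m : Fin n →₀ ℕ) :
    coeff m (derivCoeffs δ P) = δ (coeff m P) := by
  classical
  rw [derivCoeffs, coeff_sum]
  simp only [coeff_monomial]
  rw [Finset.sum_ite_eq']
  split_ifs with h
  · rfl
  · rw [notMem_support_iff.mp h, map_zero]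

/-- `(C a)^δ = C (δ a)`. [folklore] -/
theorem derivCoeffs_C (a : ℂ) : derivCoeffs δ (C a : MvPolynomial (Fin n) ℂ) = C (δ a) := by
  classical
  ext m
  rw [coeff_derivCoeffs, coeff_C, coeff_C, apply_ite δ, map_zero]

/-- `(p + q)^δ = p^δ + q^δ`. [folklore] -/
theorem derivCoeffs_add (p q : MvPolynomial (Fin n) ℂ) :
    derivCoeffs δ (p + q) = derivCoeffs δ p + derivCoeffs δ q := by
  ext m
  simp only [coeff_derivCoeffs, coeff_add, map_add]

/-- `(p · xᵢ)^δ = p^δ · xᵢ`. [folklore] -/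
theorem derivCoeffs_mul_X (p : MvPolynomial (Fin n) ℂ) (i : Fin n) :
    derivCoeffs δ (p * X i) = derivCoeffs δ p * X i := by
  classical
  ext m
  rw [coeff_derivCoeffs, coeff_mul_X', coeff_mul_X', coeff_derivCoeffs, apply_ite δ, map_zero]

/-- If `δ` kills every coefficient of `P` then `P^δ = 0`. [folklore] -/
theorem derivCoeffs_eq_zero {P : MvPolynomial (Fin n) ℂ} (h : ∀ m, δ (coeff m P) = 0) :
    derivCoeffs δ P = 0 := by
  ext m
  rw [coeff_derivCoeffs, h m, coeff_zero]

/-- **Chain rule for a derivation and a polynomial**: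
`δ(P(u)) = P^δ(u) + Σᵢ (∂P/∂xᵢ)(u) · δ(uᵢ)`. [cite: Lang2002, Ch. VIII §5] -/
theorem derivation_eval (u : Fin n → ℂ) (P : MvPolynomial (Fin n) ℂ) :
    δ (eval u P) = eval u (derivCoeffs δ P) + ∑ i, eval u (pderiv i P) * δ (u i) := by
  induction P using MvPolynomial.induction_on with
  | C a =>
    simp only [eval_C, derivCoeffs_C, pderiv_C, map_zero, zero_mul, Finset.sum_const_zero,
      add_zero]
  | add p q hp hq =>
    rw [map_add, map_add, hp, hq, derivCoeffs_add, map_add]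
    simp only [map_add, add_mul, Finset.sum_add_distrib]
    ring
  | mul_X p i hp =>
    have key : ∀ k, eval u (pderiv k (p * X i)) * δ (u k) =
        eval u (pderiv k p) * δ (u k) * u i + (if k = i then eval u p * δ (u i) else 0) := by
      intro k
      rw [pderiv_mul, map_add, map_mul, map_mul, eval_X]
      by_cases hk : k = i
      · subst hk
        rw [pderiv_X_self, map_one, if_pos rfl]
        ring
      · rw [pderiv_X_of_ne (fun h => hk h.symm), map_zero, if_neg hk]
        ring
    have hsum : (∑ k, eval u (pderiv k (p * X i)) * δ (u k)) =
        (∑ k, eval u (pderiv k p) * δ (u k)) * u i + eval u p * δ (u i) := by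
      rw [Finset.sum_congr rfl fun k _ => key k, Finset.sum_add_distrib, Finset.sum_mul,
        Finset.sum_ite_eq' Finset.univ i, if_pos (Finset.mem_univ _)]
    rw [hsum, map_mul, eval_X, Derivation.leibniz, hp, derivCoeffs_mul_X, map_mul, eval_X,
      smul_eq_mul, smul_eq_mul]
    ring

/-- A `ℚ`-derivation of `ℂ` kills every algebraic number. [cite: Lang2002, Ch. VIII §5] -/
theorem derivation_apply_eq_zero_of_isAlgebraic {x : ℂ} (hx : IsAlgebraic ℚ x) : δ x = 0 :=
  derivation_eq_zero_of_isAlgebraic (F := ℚ) δ (fun c => δ.map_algebraMap c) hx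

/-- **Chain rule for a polynomial with algebraic coefficients**:
`δ(P(u)) = Σᵢ (∂P/∂xᵢ)(u) · δ(uᵢ)`. [cite: Lang2002, Ch. VIII §5] -/
theorem derivation_eval_of_hasAlgCoeffs (u : Fin n → ℂ) {P : MvPolynomial (Fin n) ℂ}
    (hP : HasAlgCoeffs P) : δ (eval u P) = ∑ i, eval u (pderiv i P) * δ (u i) := by
  rw [derivation_eval, derivCoeffs_eq_zero δ fun m => derivation_apply_eq_zero_of_isAlgebraic δ
    (hP m), map_zero, zero_add]

end Derivations

/-! ### Non-degenerate solutions of algebraic systems are algebraic -/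

/-- Splitting a sum over the coordinates of `ℂ^{d+1}` into the distinguished coordinate `i₀` and
the `d` coordinates `a(k)`. [folklore] -/
theorem sum_eq_add_sum_of_coords {n d : ℕ} (hn : n = d + 1) (a : Fin d → Fin n) (i₀ : Fin n)
    (ha : Function.Injective a) (hi₀ : ∀ k, a k ≠ i₀) (f : Fin n → ℂ) :
    ∑ i, f i = f i₀ + ∑ k, f (a k) := by
  let g : Fin 1 ⊕ Fin d → Fin n := Sum.elim (fun _ => i₀) a
  have hg : Function.Bijective g := by
    rw [Fintype.bijective_iff_injective_and_card]
    refine ⟨Function.Injective.sumElim (fun x y _ => Subsingleton.elim x y) ha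
      (fun _ k h => hi₀ k h.symm), ?_⟩
    simp only [Fintype.card_sum, Fintype.card_fin, hn]
    omega
  rw [← Equiv.sum_comp (Equiv.ofBijective g hg), Fintype.sum_sum_type]
  simp [g]

/-- **A non-degenerate solution of a square polynomial system over `ℚ̄` is algebraic.** Let
`F_{j(l)}`, `l < d`, be complex polynomials in `n = d + 1` variables with algebraic coefficients,
`z ∈ ℂⁿ` a common zero at which the Jacobian minor `(∂F_{j(l)}/∂x_{a(k)}(z))_{k,l}` in the `d`
coordinates other than `x_{i₀}` is invertible, and suppose `z_{i₀} ∈ ℚ̄`. Then `z ∈ ℚ̄ⁿ`.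
(Were `z_{a(k₁)}` transcendental, a derivation `∂` of `ℂ/ℚ` with `∂ z_{a(k₁)} = 1` applied to
the equations gives `Σ_k ∂F_{j(l)}/∂x_{a(k)}(z) · ∂z_{a(k)} = 0`, a non-zero kernel vector.)
[cite: Lang2002, Ch. VIII §5] -/
theorem isAlgebraic_of_jacobianMinor {n d m : ℕ} (hn : n = d + 1)
    (F : Fin m → MvPolynomial (Fin n) ℂ) (hF : ∀ j, HasAlgCoeffs (F j))
    (j : Fin d → Fin m) (a : Fin d → Fin n) (i₀ : Fin n) (ha : Function.Injective a)
    (hi₀ : ∀ k, a k ≠ i₀) (z : Fin n → ℂ) (hz : ∀ l, eval z (F (j l)) = 0)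
    (hdet : (Matrix.of fun k l : Fin d => eval z (pderiv (a k) (F (j l)))).det ≠ 0)
    (h0 : IsAlgebraic ℚ (z i₀)) : ∀ i, IsAlgebraic ℚ (z i) := by
  classical
  -- every coordinate is `i₀` or some `a k`
  have hcov : ∀ i, i ≠ i₀ → ∃ k, a k = i := by
    intro i hi
    by_contra hne
    have hinj : Function.Injective (Sum.elim (fun _ : Fin 1 => i₀) (Sum.elim (fun _ : Fin 1 => i) a)) := by
      refine Function.Injective.sumElim (fun x y _ => Subsingleton.elim x y)
        (Function.Injective.sumElim (fun x y _ => Subsingleton.elim x y) ha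
          fun _ k h => hne ⟨k, h.symm⟩) ?_
      rintro _ (_ | k) h
      · exact hi h.symm
      · exact hi₀ k h.symm
    have hcard := Fintype.card_le_of_injective _ hinj
    simp only [Fintype.card_sum, Fintype.card_fin, hn] at hcard
    omega
  intro i
  by_contra htr
  obtain ⟨k₁, rfl⟩ := hcov i fun h => htr (h ▸ h0)
  -- the derivation `∂/∂ z_{a k₁}`
  obtain ⟨_, _, _, δ, hδ1, _, _⟩ := exists_derivation_of_transcendental (k := ℚ) (K := ℂ) htr
  have hrel : ∀ l, ∑ k, eval z (pderiv (a k) (F (j l))) * δ (z (a k)) = 0 := by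
    intro l
    have h := derivation_eval_of_hasAlgCoeffs δ z (hF (j l))
    rw [hz l, map_zero, sum_eq_add_sum_of_coords hn a i₀ ha hi₀,
      derivation_apply_eq_zero_of_isAlgebraic δ h0, mul_zero, zero_add] at h
    exact h.symm
  have hvec : (fun k => δ (z (a k))) ᵥ* (Matrix.of fun k l : Fin d =>
      eval z (pderiv (a k) (F (j l)))) = 0 := by
    funext l
    rw [Matrix.vecMul, dotProduct, Pi.zero_apply, ← hrel l]
    exact Finset.sum_congr rfl fun k _ => by rw [Matrix.of_apply, mul_comm]
  have hzero := Matrix.eq_zero_of_vecMul_eq_zero hdet hvec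
  have h1 : δ (z (a k₁)) = 0 := congrFun hzero k₁
  rw [hδ1] at h1
  exact one_ne_zero h1

/-! ### `ℚ̄` is dense in `ℂ` -/

/-- `q₁ + q₂ i` is algebraic for rational `q₁, q₂` (`i` is: `Complex.isIntegral_rat_I`). [folklore] -/
theorem isAlgebraic_ratCast_add_ratCast_mul_I (q₁ q₂ : ℚ) :
    IsAlgebraic ℚ ((q₁ : ℂ) + (q₂ : ℂ) * Complex.I) := by
  have h1 : IsAlgebraic ℚ (q₁ : ℂ) := by
    rw [← map_ratCast (algebraMap ℚ ℂ), Rat.cast_id]; exact isAlgebraic_algebraMap q₁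
  have h2 : IsAlgebraic ℚ (q₂ : ℂ) := by
    rw [← map_ratCast (algebraMap ℚ ℂ), Rat.cast_id]; exact isAlgebraic_algebraMap q₂
  exact h1.add (h2.mul Complex.isIntegral_rat_I.isAlgebraic)

/-- **The algebraic numbers are dense in `ℂ`** (already `ℚ(i)` is). [folklore] -/
theorem dense_setOf_isAlgebraic : Dense {w : ℂ | IsAlgebraic ℚ w} := by
  refine Metric.dense_iff.mpr fun x ε hε => ?_
  obtain ⟨q₁, hq₁⟩ := Metric.denseRange_iff.mp Rat.denseRange_cast x.re (ε / 2) (half_pos hε)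
  obtain ⟨q₂, hq₂⟩ := Metric.denseRange_iff.mp Rat.denseRange_cast x.im (ε / 2) (half_pos hε)
  refine ⟨(q₁ : ℂ) + (q₂ : ℂ) * Complex.I, ?_, isAlgebraic_ratCast_add_ratCast_mul_I q₁ q₂⟩
  rw [Metric.mem_ball, Complex.dist_eq]
  have hx : ((q₁ : ℂ) + (q₂ : ℂ) * Complex.I) - x =
      ((q₁ - x.re : ℝ) : ℂ) + ((q₂ - x.im : ℝ) : ℂ) * Complex.I := by
    apply Complex.ext <;> simp
  rw [hx]
  calc ‖((q₁ - x.re : ℝ) : ℂ) + ((q₂ - x.im : ℝ) : ℂ) * Complex.I‖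
      ≤ ‖((q₁ - x.re : ℝ) : ℂ)‖ + ‖((q₂ - x.im : ℝ) : ℂ) * Complex.I‖ := norm_add_le _ _
    _ = |(q₁ : ℝ) - x.re| + |(q₂ : ℝ) - x.im| := by
        rw [norm_mul, Complex.norm_I, mul_one, Complex.norm_real, Complex.norm_real,
          Real.norm_eq_abs, Real.norm_eq_abs]
    _ < ε / 2 + ε / 2 := by
        gcongr
        · rw [abs_sub_comm]; exact hq₁
        · rw [abs_sub_comm]; exact hq₂
    _ = ε := add_halves ε

/-! ### Density of algebraic points on a smooth affine curve -/

/-- The Jacobian minor `det (∂F_{j(l)}/∂x_{a(k)}(z))` is a continuous function of `z`. [folklore] -/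
theorem continuous_minorDet {n d m : ℕ} (F : Fin m → MvPolynomial (Fin n) ℂ) (j : Fin d → Fin m)
    (a : Fin d → Fin n) :
    Continuous fun z : Fin n → ℂ =>
      (Matrix.of fun k l : Fin d => eval z (pderiv (a k) (F (j l)))).det :=
  (continuous_matrix fun _ _ => MvPolynomial.continuous_eval _).matrix_det

variable {Z : CurveData}

/-- **The algebraic points of a smooth affine curve over `ℚ̄` are dense in its complex points**:
every `z₀ ∈ Z(ℂ)` lies in the closure of `Z(ℚ̄) = {z ∈ Z(ℂ) | z ∈ ℚ̄ⁿ}` (local chart over the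
free coordinate of an invertible Jacobian minor, an algebraic value of that coordinate close to
`z₀,ᵢ₀`, and `isAlgebraic_of_jacobianMinor`). This is the density of `Z(ℚ̄)` invoked in the
rendering of relation (R5) of `HuberWustholzCurvePeriods`.
[cite: HuberWustholz2022, §3.3.1 (p. 44)] -/
theorem CurveData.IsSmoothAffineCurve.mem_closure_algebraicPoints (hZ : Z.IsSmoothAffineCurve)
    {z₀ : Fin Z.n → ℂ} (hz₀ : z₀ ∈ Z.points) :
    z₀ ∈ closure {z ∈ Z.points | ∀ i, IsAlgebraic ℚ (z i)} := by
  classical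
  obtain ⟨d, hn⟩ := Nat.exists_eq_succ_of_ne_zero (n_ne_zero_of_mem hZ hz₀)
  obtain ⟨j, a, i₀, ha, hi₀, hdet⟩ := exists_jacobianMinor hZ hz₀ hn
  obtain ⟨ε, Ω, ψ, hε, _, hz₀Ω, hψ, h1, h2⟩ :=
    exists_localChart_of_minor hZ hz₀ hn j a i₀ ha hi₀ hdet
  rw [_root_.mem_closure_iff]
  intro O hO hz₀O
  -- the parameters `w` with `ψ(w) ∈ O` and invertible minor at `ψ(w)` form an open set `∋ z₀ i₀`
  let U : Set (Fin Z.n → ℂ) :=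
    {z | (Matrix.of fun k l : Fin d => eval z (pderiv (a k) (Z.F (j l)))).det ≠ 0}
  have hUo : IsOpen U := isOpen_ne_fun (continuous_minorDet Z.F j a) continuous_const
  have hz₀U : z₀ ∈ U := hdet
  have hWo : IsOpen (Metric.ball (z₀ i₀) ε ∩ ψ ⁻¹' (O ∩ U)) :=
    hψ.continuousOn.isOpen_inter_preimage Metric.isOpen_ball (hO.inter hUo)
  have hw₀ : z₀ i₀ ∈ Metric.ball (z₀ i₀) ε ∩ ψ ⁻¹' (O ∩ U) := by
    refine ⟨Metric.mem_ball_self hε, ?_⟩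
    rw [Set.mem_preimage, (h1 z₀ hz₀Ω hz₀).2]
    exact ⟨hz₀O, hz₀U⟩
  -- an algebraic parameter in it
  obtain ⟨w, ⟨hwB, hwO, hwU⟩, hwalg⟩ :=
    dense_setOf_isAlgebraic.inter_open_nonempty _ hWo ⟨_, hw₀⟩
  obtain ⟨_, hwZ, hwi⟩ := h2 w hwB
  refine ⟨ψ w, hwO, hwZ, ?_⟩
  have h0 : IsAlgebraic ℚ (ψ w i₀) := by
    rw [hwi]
    exact hwalg
  exact isAlgebraic_of_jacobianMinor hn Z.F hZ.algebraic j a i₀ ha hi₀ (ψ w)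
    (fun l => hwZ (j l)) hwU h0

/-- **Density, open-set form**: every open set of `ℂⁿ` meeting `Z(ℂ)` contains a point of
`Z(ℚ̄)`. [cite: HuberWustholz2022, §3.3.1 (p. 44)] -/
theorem CurveData.IsSmoothAffineCurve.exists_algebraicPoint_mem (hZ : Z.IsSmoothAffineCurve)
    {z₀ : Fin Z.n → ℂ} (hz₀ : z₀ ∈ Z.points) {O : Set (Fin Z.n → ℂ)} (hO : IsOpen O)
    (hz₀O : z₀ ∈ O) : ∃ z ∈ O, z ∈ Z.points ∧ ∀ i, IsAlgebraic ℚ (z i) := by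
  obtain ⟨z, hzO, hz⟩ := _root_.mem_closure_iff.mp (hZ.mem_closure_algebraicPoints hz₀) O hO hz₀O
  exact ⟨z, hzO, hz⟩

end CurvePeriods

end Literature.NumberTheory.Transcendental

end
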